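import Literature.MathematicalPhysics.QuantumLattice.GrassmannEffectiveAction
import Literature.MathematicalPhysics.QuantumLattice.GrassmannLaplacianTreeExpansion
import HarnessLib

/-!
# Decoupled blocks of fields: the Gaussian convolution and the effective action FACTORISE / ADD

Topic `MathematicalPhysics/QuantumLattice`; continuation of `GrassmannEffectiveAction` (the effective action `effAction C V` and its
semigroup property) and `GrassmannPairLaplacians` (field-supported subalgebras `fieldSubalgebra R S` and the support calculus of the
Laplacian `Δ_C`; `GrassmannLaplacianTreeExpansion.exp_apply_mul_left`).  If the covariance `C` does not couple a block of fields `S ⊆ Γ` to its complement (`C X Y = 0` whenever exactly one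
of `X, Y` lies in `S` — two INDEPENDENT Gaussian fields), then for an even `a` supported on `S` and any `b` supported on `Sᶜ`

* `gaussConv_mul_of_blockDiag` — **`μ_C ⋆ (a b) = (μ_C ⋆ a)(μ_C ⋆ b)`** (independence: the Gaussian convolution factorises; Salmhofer
  1999, §2.2 / (4.84): `∫ dμ_{C₁ ⊕ C₂} F(ψ₁) G(ψ₂) = ∫dμ_{C₁} F · ∫dμ_{C₂} G`), via `Δ_C = Δ_{C|S} + Δ_{C|Sᶜ}`, `μ_C ⋆ = e^{Δ_{C|S}} e^{Δ_{C|Sᶜ}}`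
  and the support calculus (`grassmannLaplacian_mul_eq_mul_of_mem{,_right}`, `grassmannLaplacian_eq_zero_of_mem`);

and for interactions `V₁` (even, supported on `S`, no constant part) and `V₂` (supported on `Sᶜ`, no constant part)

* `effBoltzmann_add_of_blockDiag` — `μ_C ⋆ e^{-(V₁+V₂)} = (μ_C ⋆ e^{-V₁})(μ_C ⋆ e^{-V₂})`, `effPartitionFn_add_of_blockDiag` — `Z(V₁+V₂) = Z(V₁)Z(V₂)`;
* **`effAction_add_of_blockDiag`** — **`effAction C (V₁ + V₂) = effAction C V₁ + effAction C V₂`** (when `Z(V₁)`, `Z(V₂)` are units): the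
  effective action of two decoupled blocks is the sum of the blocks' effective actions (Salmhofer 1999, (2.102)–(2.106); the `b²`
  decoupled copies of a small torus inside a large one, the decoupled point of a cluster interpolation, …).

Tools of independent use: `exp_apply_mul_right` (right twin of `GrassmannLaplacianTreeExpansion.exp_apply_mul_left`: a nilpotent endomorphism
that passes a right factor has an exponential that does), `grassmannExp_mem_fieldSubalgebra`, `grassmannLog1p_mul_of_commute`
(`log((1+x)(1+y)) = log(1+x) + log(1+y)` for commuting nilpotents).  Everything is proved; no definition, no named fact.

## Sources
M. Salmhofer, *Renormalization: An Introduction* (Springer 1999), §2.2, Def. 2.19 (2.102)–(2.106), §4.3 (4.84)–(4.88)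
[`Salmhofer1999`]; F. A. Berezin, *The Method of Second Quantization* (1966), Ch. I §3 [`Berezin1966`].
-/

noncomputable section

namespace Literature.MathematicalPhysics.QuantumLattice

open GrassmannAlgebra Finset

/-! ### Exponentials of endomorphisms commuting with a multiplication -/

section ExpMul

variable (R : Type*) [CommRing R] [Algebra ℚ R] {Γ : Type*}

/-- If a nilpotent endomorphism `T` satisfies `T (y b) = (T y) b` for all `y`, then so does `e^T = Σ_k T^k/k!` (the `e^{Δ_C}` calculus of
Salmhofer 1999, §4.3.1). [cite: Salmhofer1999, §4.3.1 (4.86)-(4.88)] -/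
theorem exp_apply_mul_right {T : Module.End R (GrassmannAlgebra R Γ)} (hT : IsNilpotent T) {b : GrassmannAlgebra R Γ}
    (h : ∀ y, T (y * b) = T y * b) (y : GrassmannAlgebra R Γ) : IsNilpotent.exp T (y * b) = IsNilpotent.exp T y * b := by
  obtain ⟨k, hk⟩ := hT
  have hp : ∀ (n : ℕ) (y : GrassmannAlgebra R Γ), (T ^ n) (y * b) = (T ^ n) y * b := by
    intro n
    induction n with
    | zero => intro y; simp
    | succ n ih => intro y; rw [pow_succ, Module.End.mul_apply, h, ih, Module.End.mul_apply]
  rw [IsNilpotent.exp_eq_sum hk, LinearMap.coe_sum, Finset.sum_apply, Finset.sum_apply, Finset.sum_mul]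
  refine Finset.sum_congr rfl fun n _ => ?_
  rw [LinearMap.smul_apply, LinearMap.smul_apply, hp, smul_mul_assoc]

/-- The exponential `e^x = Σ_k x^k/k!` of a nilpotent element stays in a field-supported subalgebra (Berezin 1966, Ch. I §3: functions of
Grassmann elements are finite polynomials). [cite: Berezin1966, Ch. I §3] -/
theorem grassmannExp_mem_fieldSubalgebra [DecidableEq Γ] {S : Set Γ} {x : GrassmannAlgebra R Γ} (hx : x ∈ fieldSubalgebra R S)
    (hn : IsNilpotent x) : grassmannExp x ∈ fieldSubalgebra R S := by
  obtain ⟨k, hk⟩ := hn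
  rw [grassmannExp, IsNilpotent.exp_eq_sum hk]
  refine Subalgebra.sum_mem _ fun n _ => ?_
  rw [← algebraMap_smul R]
  exact Subalgebra.smul_mem _ (Subalgebra.pow_mem _ hx n) _

/-- **`log((1+x)(1+y)) = log(1+x) + log(1+y)`** for nilpotents `x, y` whose logarithms commute (through `exp`/`log` on
nilpotents, Berezin 1966 Ch. I §3: `e^{log(1+x) + log(1+y)} = (1+x)(1+y)`). [cite: Berezin1966, Ch. I §3] -/
theorem grassmannLog1p_mul_of_commute [Fintype Γ] {x y : GrassmannAlgebra R Γ} (hx : IsNilpotent x) (hy : IsNilpotent y)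
    (hlog : Commute (grassmannLog1p R x) (grassmannLog1p R y)) :
    grassmannLog1p R ((1 + x) * (1 + y) - 1) = grassmannLog1p R x + grassmannLog1p R y := by
  have hex : grassmannExp (grassmannLog1p R x) = 1 + x := grassmannExp_grassmannLog1p R hx
  have hey : grassmannExp (grassmannLog1p R y) = 1 + y := grassmannExp_grassmannLog1p R hy
  have hnx := isNilpotent_grassmannLog1p R x
  have hny := isNilpotent_grassmannLog1p R y
  have hsum : IsNilpotent (grassmannLog1p R x + grassmannLog1p R y) := Commute.isNilpotent_add hlog hnx hny
  have hprod : grassmannExp (grassmannLog1p R x + grassmannLog1p R y) = (1 + x) * (1 + y) := by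
    rw [grassmannExp, IsNilpotent.exp_add_of_commute hlog hnx hny, ← hex, ← hey, grassmannExp, grassmannExp]
  rw [← hprod, grassmannLog1p_grassmannExp_sub_one R hsum]

end ExpMul

/-! ### Independent blocks: the Gaussian convolution factorises -/

section Blocks

variable (R : Type*) [CommRing R] [Algebra ℚ R] {Γ : Type*} [Fintype Γ] [DecidableEq Γ]

/-- **Independence of decoupled blocks under the Gaussian convolution.**  If `C` does not couple the block `S` to its complement,
then for an even `a` supported on `S` and any `b` supported on `Sᶜ`, `μ_C ⋆ (a b) = (μ_C ⋆ a)(μ_C ⋆ b)`.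
[cite: Salmhofer1999, §4.3 (4.84)] -/
theorem gaussConv_mul_of_blockDiag {S : Set Γ} (C : Matrix Γ Γ R)
    (hC₁ : ∀ X Y, X ∈ S → Y ∉ S → C X Y = 0) (hC₂ : ∀ X Y, X ∉ S → Y ∈ S → C X Y = 0)
    {a b : GrassmannAlgebra R Γ} (ha : a ∈ fieldSubalgebra R S) (ha0 : a ∈ evenOdd R 0) (hb : b ∈ fieldSubalgebra R Sᶜ) :
    gaussConv R C (a * b) = gaussConv R C a * gaussConv R C b := by
  classical
  -- the block split `C = C_in + C_out` (rows in `S` / rows outside `S`)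
  set Cin : Matrix Γ Γ R := Matrix.of fun X Y => if X ∈ S then C X Y else 0 with hCin
  set Cout : Matrix Γ Γ R := Matrix.of fun X Y => if X ∈ S then 0 else C X Y with hCout
  have hsplit : C = Cin + Cout := by
    ext X Y
    simp only [hCin, hCout, Matrix.add_apply, Matrix.of_apply]
    split_ifs <;> simp
  have hin : ∀ X Y, X ∈ Sᶜ ∨ Y ∈ Sᶜ → Cin X Y = 0 := by
    intro X Y hXY
    simp only [hCin, Matrix.of_apply]
    split_ifs with hX
    · rcases hXY with hX' | hY'
      · exact absurd hX hX'
      · exact hC₁ X Y hX hY'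
    · rfl
  have hout : ∀ X Y, X ∈ S ∨ Y ∈ S → Cout X Y = 0 := by
    intro X Y hXY
    simp only [hCout, Matrix.of_apply]
    split_ifs with hX
    · rfl
    · rcases hXY with hX' | hY'
      · exact absurd hX' hX
      · exact hC₂ X Y hX hY'
  have hin0 : ∀ X Y, X ∈ Sᶜ → Y ∈ Sᶜ → Cin X Y = 0 := fun X Y hX _ => hin X Y (Or.inl hX)
  have hout0 : ∀ X Y, X ∈ S → Y ∈ S → Cout X Y = 0 := fun X Y hX _ => hout X Y (Or.inl hX)
  -- the support calculus at the level of `e^{Δ}`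
  have gC : ∀ F, gaussConv R C F = gaussConv R Cin (gaussConv R Cout F) := fun F => by
    rw [hsplit]; exact gaussConv_add_apply R Cin Cout F
  have e1 : ∀ y, gaussConv R Cout (a * y) = a * gaussConv R Cout y := fun y => by
    rw [gaussConv_def]
    exact exp_apply_mul_left R (isNilpotent_grassmannLaplacian R Cout)
      (fun z => grassmannLaplacian_mul_eq_mul_of_mem R Cout hout ha ha0 z) y
  have e2 : ∀ {b' : GrassmannAlgebra R Γ}, b' ∈ fieldSubalgebra R Sᶜ → ∀ y, gaussConv R Cin (y * b') = gaussConv R Cin y * b' :=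
    fun hb' y => by
      rw [gaussConv_def]
      exact exp_apply_mul_right R (isNilpotent_grassmannLaplacian R Cin)
        (fun z => grassmannLaplacian_mul_eq_mul_of_mem_right R Cin hin z hb') y
  have e3 : gaussConv R Cout a = a := by
    rw [gaussConv_def]
    exact exp_apply_eq_self_of_apply_eq_zero R (isNilpotent_grassmannLaplacian R Cout)
      (grassmannLaplacian_eq_zero_of_mem R Cout hout0 ha)
  have hb'' : gaussConv R Cout b ∈ fieldSubalgebra R Sᶜ := gaussConv_mem_fieldSubalgebra R Cout hb
  have e4 : gaussConv R Cin (gaussConv R Cout b) = gaussConv R Cout b := by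
    rw [gaussConv_def R Cin]
    exact exp_apply_eq_self_of_apply_eq_zero R (isNilpotent_grassmannLaplacian R Cin)
      (grassmannLaplacian_eq_zero_of_mem R Cin hin0 hb'')
  calc gaussConv R C (a * b) = gaussConv R Cin (gaussConv R Cout (a * b)) := gC _
    _ = gaussConv R Cin (a * gaussConv R Cout b) := by rw [e1]
    _ = gaussConv R Cin a * gaussConv R Cout b := e2 hb'' a
    _ = gaussConv R C a * gaussConv R C b := by rw [gC a, e3, gC b, e4]

end Blocks

/-! ### Independent blocks: Boltzmann factors multiply, partition functions multiply, effective actions add -/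

section EffAction

variable (R : Type*) [CommRing R] [Algebra ℚ R] {Γ : Type*} [Fintype Γ] [DecidableEq Γ]

variable {S : Set Γ} (C : Matrix Γ Γ R)

/-- **Decoupled blocks: the effective Boltzmann factors multiply**, `μ_C ⋆ e^{-(V₁+V₂)} = (μ_C ⋆ e^{-V₁})(μ_C ⋆ e^{-V₂})`, for `V₁` even,
supported on `S`, `V₂` supported on `Sᶜ`, both without constant part. [cite: Salmhofer1999, §4.3 (4.84)-(4.88)] -/
theorem effBoltzmann_add_of_blockDiag (hC₁ : ∀ X Y, X ∈ S → Y ∉ S → C X Y = 0) (hC₂ : ∀ X Y, X ∉ S → Y ∈ S → C X Y = 0)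
    {V₁ V₂ : GrassmannAlgebra R Γ} (hV₁ : V₁ ∈ fieldSubalgebra R S) (hV₁e : V₁ ∈ evenOdd R 0) (hV₁c : constPart R V₁ = 0)
    (hV₂ : V₂ ∈ fieldSubalgebra R Sᶜ) (hV₂c : constPart R V₂ = 0) :
    effBoltzmann R C (V₁ + V₂) = effBoltzmann R C V₁ * effBoltzmann R C V₂ := by
  have hn₁ : IsNilpotent (-V₁) := isNilpotent_of_constPart_eq_zero R (by rw [map_neg, hV₁c, neg_zero])
  have hn₂ : IsNilpotent (-V₂) := isNilpotent_of_constPart_eq_zero R (by rw [map_neg, hV₂c, neg_zero])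
  have he₁ : -V₁ ∈ evenOdd R 0 := Submodule.neg_mem _ hV₁e
  have hexp : grassmannExp (-(V₁ + V₂)) = grassmannExp (-V₁) * grassmannExp (-V₂) := by
    rw [neg_add, grassmannExp, IsNilpotent.exp_add_of_commute (commute_of_mem_evenOdd_zero R he₁ _) hn₁ hn₂, grassmannExp, grassmannExp]
  rw [effBoltzmann_def, hexp, effBoltzmann_def, effBoltzmann_def]
  exact gaussConv_mul_of_blockDiag R C hC₁ hC₂ (grassmannExp_mem_fieldSubalgebra R (Subalgebra.neg_mem _ hV₁) hn₁)
    (grassmannExp_mem_evenOdd_zero R he₁ hn₁) (grassmannExp_mem_fieldSubalgebra R (Subalgebra.neg_mem _ hV₂) hn₂)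

/-- **Decoupled blocks: the partition functions multiply**, `Z(V₁+V₂) = Z(V₁)·Z(V₂)`. [cite: Salmhofer1999, §2.2] -/
theorem effPartitionFn_add_of_blockDiag (hC₁ : ∀ X Y, X ∈ S → Y ∉ S → C X Y = 0) (hC₂ : ∀ X Y, X ∉ S → Y ∈ S → C X Y = 0)
    {V₁ V₂ : GrassmannAlgebra R Γ} (hV₁ : V₁ ∈ fieldSubalgebra R S) (hV₁e : V₁ ∈ evenOdd R 0) (hV₁c : constPart R V₁ = 0)
    (hV₂ : V₂ ∈ fieldSubalgebra R Sᶜ) (hV₂c : constPart R V₂ = 0) :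
    effPartitionFn R C (V₁ + V₂) = effPartitionFn R C V₁ * effPartitionFn R C V₂ := by
  rw [effPartitionFn, effBoltzmann_add_of_blockDiag R C hC₁ hC₂ hV₁ hV₁e hV₁c hV₂ hV₂c, map_mul]
  rfl

/-- **DECOUPLED BLOCKS: THE EFFECTIVE ACTIONS ADD.**  If `C` does not couple the block `S` to its complement, `V₁` is even, supported on
`S`, `V₂` is supported on `Sᶜ`, both have no constant part and both partition functions are units, then
`effAction C (V₁ + V₂) = effAction C V₁ + effAction C V₂`. [cite: Salmhofer1999, Def. 2.19 (2.102)-(2.106)] -/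
theorem effAction_add_of_blockDiag (hC₁ : ∀ X Y, X ∈ S → Y ∉ S → C X Y = 0) (hC₂ : ∀ X Y, X ∉ S → Y ∈ S → C X Y = 0)
    {V₁ V₂ : GrassmannAlgebra R Γ} (hV₁ : V₁ ∈ fieldSubalgebra R S) (hV₁e : V₁ ∈ evenOdd R 0) (hV₁c : constPart R V₁ = 0)
    (hV₂ : V₂ ∈ fieldSubalgebra R Sᶜ) (hV₂c : constPart R V₂ = 0)
    (hZ₁ : IsUnit (effPartitionFn R C V₁)) (hZ₂ : IsUnit (effPartitionFn R C V₂)) :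
    effAction R C (V₁ + V₂) = effAction R C V₁ + effAction R C V₂ := by
  set Z₁ := effPartitionFn R C V₁ with hZ₁d
  set Z₂ := effPartitionFn R C V₂ with hZ₂d
  set B₁ := effBoltzmann R C V₁ with hB₁
  set B₂ := effBoltzmann R C V₂ with hB₂
  set x₁ : GrassmannAlgebra R Γ := Ring.inverse Z₁ • B₁ - 1 with hx₁
  set x₂ : GrassmannAlgebra R Γ := Ring.inverse Z₂ • B₂ - 1 with hx₂
  have hZ : effPartitionFn R C (V₁ + V₂) = Z₁ * Z₂ := effPartitionFn_add_of_blockDiag R C hC₁ hC₂ hV₁ hV₁e hV₁c hV₂ hV₂c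
  have hB : effBoltzmann R C (V₁ + V₂) = B₁ * B₂ := effBoltzmann_add_of_blockDiag R C hC₁ hC₂ hV₁ hV₁e hV₁c hV₂ hV₂c
  -- no constant parts ⇒ nilpotent
  have hx₁c : constPart R x₁ = 0 := by
    rw [hx₁, map_sub, map_smul, map_one, smul_eq_mul, hB₁, ← effPartitionFn, Ring.inverse_mul_cancel _ hZ₁, sub_self]
  have hx₂c : constPart R x₂ = 0 := by
    rw [hx₂, map_sub, map_smul, map_one, smul_eq_mul, hB₂, ← effPartitionFn, Ring.inverse_mul_cancel _ hZ₂, sub_self]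
  have hx₁n : IsNilpotent x₁ := isNilpotent_of_constPart_eq_zero R hx₁c
  have hx₂n : IsNilpotent x₂ := isNilpotent_of_constPart_eq_zero R hx₂c
  -- `x₁` is even (so its logarithm is central)
  have hn₁ : IsNilpotent (-V₁) := isNilpotent_of_constPart_eq_zero R (by rw [map_neg, hV₁c, neg_zero])
  have hB₁e : B₁ ∈ evenOdd R 0 := by
    rw [hB₁, effBoltzmann_def]
    exact gaussConv_mem_evenOdd R C (grassmannExp_mem_evenOdd_zero R (Submodule.neg_mem _ hV₁e) hn₁)
  have hx₁e : x₁ ∈ evenOdd R 0 := by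
    rw [hx₁]
    refine Submodule.sub_mem _ (Submodule.smul_mem _ _ hB₁e) ?_
    exact (mem_evenPart_iff).1 (Subalgebra.one_mem _)
  have hlog : Commute (grassmannLog1p R x₁) (grassmannLog1p R x₂) := by
    refine commute_of_mem_evenOdd_zero R ?_ _
    rw [grassmannLog1p]
    refine Submodule.sum_mem _ fun n _ => ?_
    rw [← algebraMap_smul R]
    exact Submodule.smul_mem _ _ (pow_mem_evenOdd_zero R hx₁e n)
  -- the product of the normalised Boltzmann factors
  have hprod : Ring.inverse (effPartitionFn R C (V₁ + V₂)) • effBoltzmann R C (V₁ + V₂) - 1 = (1 + x₁) * (1 + x₂) - 1 := by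
    rw [hZ, hB, hx₁, hx₂, add_sub_cancel, add_sub_cancel, smul_mul_smul_comm, Ring.mul_inverse_rev, mul_comm (Ring.inverse Z₂)]
  rw [effAction_def, hprod, grassmannLog1p_mul_of_commute R hx₁n hx₂n hlog, neg_add, effAction_def, effAction_def]

end EffAction

end Literature.MathematicalPhysics.QuantumLattice

end
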